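import Summits.QuantumFields.BalabanUV.T4Continuum.Support.SliceFlatHeatTorus

/-!
# G-an2-4 ∕ (CONV-C), the SECOND-ORDER sup entries of the requester's refined (B5-1115-TABLE) line — flat supplier, part 1:
# exponentially WEIGHTED ℓ¹ bounds for the SECOND difference of the one-dimensional heat kernel, on `ℤ` and on `ℤ/P`

G-an2-4 formalisation swarm `b2b-balaban-gan24-formalise-*`, leaf prover 03 (gen 48), crux team (2) under the coordinator ruling
«YM REDIRECT» (e34b3e0c).  WHY THIS FILE — the road-P2 crux prover (unit `b2b-balaban-gan24-p2`, gen 29, journal `CLAIMS.log`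
l.28555) sharpened its INTERFACE REQUEST G-an2-4 (B5-1115-TABLE) to «two second-order sup entries with a `log n` allowance: the
row sums of `G∇*∇*` and the pure second differences of the minimiser» (its exact two-level law for the soft minimiser costs
`‖G′∂′ᴴ∂′ᴴ‖_{∞→∞}`, measured `≈ 1.44, 1.88, 2.30, 2.55` at `n′ = 2, 4, 8, 12` — a logarithm).  The landed first-order chain of
the NE3 prover lineage (`Support/SliceFlatHeatOneDim → SliceFlatHeatWeighted → SliceFlatHeatTorus → SliceFlatFreeKernel →
SliceFlatFreeResolvent → SliceFlatGradientPrep → SliceFlatGradient`, t4-ne3-p1 gen 15) gives block row sums of ONE unit difference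
of the flat `U = 1` propagator; this chain (`SliceFlatHeatSecond → SliceFlatHeatTorusSecond → SliceFlatFreeHessian →
SliceFlatHessian`) does the same ONE ORDER UP, where the Laplace integral `∫ min(1, t⁻¹)e^{−t/n²}dt ≍ log n` produces exactly
the requester's logarithm.  THIS FILE is the one-dimensional input: for the tree's kernel `q_t = srwHeatKernel t` of the
continuous-time simple random walk on `ℤ` (`Literature.Probability.LatticeModels.SRWHeatKernel1D`, after Lawler–Limic 2010
§2.3) and its second difference, `T = 1 ∨ t`,
 * §1 two elementary inequalities (`x·e^{−x/16} ≤ 7`, `x·e^{−x} ≤ 7/16` for `x ≥ 0`) and `(256 + 112π)/(2π) ≤ 100`;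
 * §2 the HYBRID POINTWISE BOUND **`abs_sndDiff_srw_le_hybrid`**:
   `|q_t(m+1) − 2q_t(m) + q_t(m−1)| ≤ 100·T⁻¹·T^{−1/2}·(e^{−m²/(16T)} + e^{−|m|/16})` from the tree's Chernoff bound
   `SRWHeatKernelDifferences.abs_sndDiff_srwHeatKernel_le_exp` (Gaussian regime `λ = m/t`, Poisson regime `λ = ±1`) — TWO
   factors `T^{−1/2}` beyond the kernel;
 * §3 the WEIGHTED ℓ¹ BOUND **`weighted_tsum_sndDiff_srw_le`**: `Σ_m e^{β|m|}|q_t(m+1) − 2q_t(m) + q_t(m−1)| ≤ 8400·T⁻¹·e^{8β²T}`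
   for `β ≤ 1/32`, with summability — ONE factor `T⁻¹` beyond the kernel, uniformly in the weight;
 * §4 on the discrete circle `ℤ/P` (periodisation is a weighted ℓ¹ contraction, `SliceFlatHeatTorus.sum_weight_abs_periodic_le`):
   **`weighted_sum_sndDiff_torusHeatKernel_le`** (centred form) and **`weighted_sum_fwdSndDiff_torusHeatKernel_le`** (forward
   form `q^P_t(c+2) − 2q^P_t(c+1) + q^P_t(c)`, the shape the product kernel's double row difference produces; the unit shift
   of the weight costs `e^{β} ≤ e^{1/32}`): both `≤ 8700·T⁻¹·e^{8β²T}` for `0 ≤ β ≤ 1/32`, uniformly in `P`.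
All constants are absolute.  Nothing here is specific to a gauge theory.
HONEST SCOPE.  Classical analysis of the free one-dimensional heat kernel; no statement of Bałaban's is asserted or used; a
sup → sup SECOND-ORDER bound with a `(1 + log n)` allowance (parts 3–4 of this chain) is OUR statement — [B5] (1.112) prints a
Hölder-SOURCE bound `‖J‖_ε`, no logarithm — not in print.  NOT the Hölder letters (1.111) ∕ (1.115)–(1.117), NOT (CONV-C),
NEVER «G-an2-4 closed», NOT NE2 ∕ NE3, NOT D1, NOT BetaPertH, NOT continuum, NOT Clay; not in print — our bookkeeping.  ABSOLUTE
RULE of the cell kept («No internally-minted statement may enter as a cited fact …»): the only inputs are Mathlib and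
kernel-proved tree modules used BY NAME (`SRWHeatKernelDifferences`, `TorusHeatKernel1D.torusHeatKernel_eq_tsum`, the NE3
parts 7–9); every declaration is a [folklore] theorem; no `def`, no `def … : Prop`, no `sorry`, no axioms beyond Mathlib's.
PLACEMENT (human rule 2026-08-19): our results under `Summits/QuantumFields/BalabanUV/`; nothing under `Literature/`.  HONEST
DEPENDENCY: continuum YM on T⁴ ⇐ BetaPertH ∧ nine spine estimates (0/9 proved); BetaPertH ⇐ (D1) ∧ (D4) ∧ CAP+tail; G-an2-4
gates asym, D1 and NE2/3/4.
-/

noncomputable section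

open Real Finset Filter

namespace Summit.QuantumFields.BalabanUV.Beta.GAN24.SliceFlatHeatSecond

open Literature.Probability.LatticeModels
open Summit.QuantumFields.BalabanUV.T4Continuum
open SliceFlatHeatOneDim SliceFlatHeatWeighted SliceFlatHeatTorus

/-! ## §1  Elementary inequalities -/
section Elementary
/-- `x·e^{−x/16} ≤ 7` for `x ≥ 0` (from `e^{y} ≥ 1 + y + y²/2` at `y = x/16`). [folklore] -/
theorem mul_exp_neg_div_sixteen_le {x : ℝ} (hx : 0 ≤ x) : x * Real.exp (-(x / 16)) ≤ 7 := by
  have h1 : 1 + x / 16 + (x / 16) ^ 2 / 2 ≤ Real.exp (x / 16) := Real.quadratic_le_exp_of_nonneg (by positivity)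
  have h2 : x ≤ 7 * (1 + x / 16 + (x / 16) ^ 2 / 2) := by nlinarith [sq_nonneg (x / 16 - 9 / 7)]
  have h3 : Real.exp (x / 16) * Real.exp (-(x / 16)) = 1 := by rw [← Real.exp_add, add_neg_cancel, Real.exp_zero]
  calc x * Real.exp (-(x / 16)) ≤ (7 * Real.exp (x / 16)) * Real.exp (-(x / 16)) := by
        gcongr; linarith
    _ = 7 := by rw [mul_assoc, h3, mul_one]

/-- `x·e^{−x} ≤ 7/16` for `x ≥ 0` (from `e^{x} ≥ 1 + x + x²/2`). [folklore] -/
theorem mul_exp_neg_le {x : ℝ} (hx : 0 ≤ x) : x * Real.exp (-x) ≤ 7 / 16 := by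
  have h1 : 1 + x + x ^ 2 / 2 ≤ Real.exp x := Real.quadratic_le_exp_of_nonneg hx
  have h2 : x ≤ 7 / 16 * (1 + x + x ^ 2 / 2) := by nlinarith [sq_nonneg (x - 9 / 7)]
  have h3 : Real.exp x * Real.exp (-x) = 1 := by rw [← Real.exp_add, add_neg_cancel, Real.exp_zero]
  calc x * Real.exp (-x) ≤ (7 / 16 * Real.exp x) * Real.exp (-x) := by gcongr; linarith
    _ = 7 / 16 := by rw [mul_assoc, h3, mul_one]

/-- The absolute constant of the hybrid second-difference bound: `(256 + 112π)/(2π) ≤ 100`. [folklore] -/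
theorem sndDiffConst_le : (256 + 112 * π) / (2 * π) ≤ 100 := by
  rw [div_le_iff₀ (by positivity)]
  nlinarith [Real.pi_gt_three]

end Elementary
/-! ## §2  The hybrid pointwise bound for the second difference -/
section Pointwise

/-- **Hybrid pointwise bound for the second difference**: `|q_t(m+1) − 2q_t(m) + q_t(m−1)| ≤ 100·T⁻¹·T^{−1/2}·(e^{−m²/(16T)} +
e^{−|m|/16})`, `T = 1 ∨ t`, for all `t > 0`, `m ∈ ℤ`.  From the tree's Chernoff bound `abs_sndDiff_srwHeatKernel_le_exp` with the
shift `λ = m/t` in the Gaussian regime `|m| ≤ t` (`chernoff_exponent_gauss_le`; the term `λ²T^{−1/2}e^{−m²/(8t)}` is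
`≤ 7·T⁻¹T^{−1/2}e^{−m²/(16t)}` by `x e^{−x/16} ≤ 7` at `x = m²/t`) and `λ = ±1` in the Poisson regime `|m| > t`
(`chernoff_exponent_poisson_le`; `T^{−1/2}e^{−|m|/16} ≤ 7·T⁻¹T^{−1/2}` by `T e^{−T/16} ≤ 7` and `T ≤ |m|`). [folklore] -/
theorem abs_sndDiff_srw_le_hybrid {t : ℝ} (ht : 0 < t) (m : ℤ) :
    |srwHeatKernel t (m + 1) - 2 * srwHeatKernel t m + srwHeatKernel t (m - 1)| ≤ 100 * ((max 1 t)⁻¹ * (max 1 t) ^ (-(1 / 2 : ℝ))) *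
      (Real.exp (-((m : ℝ) ^ 2 / (16 * max 1 t))) + Real.exp (-(|(m : ℝ)| / 16))) := by
  obtain ⟨hT1, hT0, hThalf, hTT, hsq⟩ := max_one_facts t
  have h2π : (0 : ℝ) < 2 * π := by positivity
  set D := |srwHeatKernel t (m + 1) - 2 * srwHeatKernel t m + srwHeatKernel t (m - 1)| with hD
  have hD0 : 0 ≤ D := abs_nonneg _
  have hA : 0 ≤ Real.exp (-((m : ℝ) ^ 2 / (16 * max 1 t))) := (Real.exp_pos _).le
  have hB : 0 ≤ Real.exp (-(|(m : ℝ)| / 16)) := (Real.exp_pos _).le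
  have hTinv : 0 ≤ (max 1 t)⁻¹ := inv_nonneg.2 hT0.le
  have hTn : 0 ≤ (max 1 t) ^ (-(1 / 2 : ℝ)) := Real.rpow_nonneg hT0.le _
  have hP0 : 0 ≤ (max 1 t)⁻¹ * (max 1 t) ^ (-(1 / 2 : ℝ)) := mul_nonneg hTinv hTn
  -- it suffices to bound `2π·D` by `(256 + 112π)·T⁻¹T^{−1/2}·(…)`
  suffices hmain : 2 * π * D ≤ (256 + 112 * π) * ((max 1 t)⁻¹ * (max 1 t) ^ (-(1 / 2 : ℝ))) *
      (Real.exp (-((m : ℝ) ^ 2 / (16 * max 1 t))) + Real.exp (-(|(m : ℝ)| / 16))) by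
    have h1 : D ≤ (256 + 112 * π) / (2 * π) * ((max 1 t)⁻¹ * (max 1 t) ^ (-(1 / 2 : ℝ))) *
        (Real.exp (-((m : ℝ) ^ 2 / (16 * max 1 t))) + Real.exp (-(|(m : ℝ)| / 16))) := by
      rw [div_mul_eq_mul_div, div_mul_eq_mul_div, le_div_iff₀ h2π]; linarith
    exact h1.trans (mul_le_mul_of_nonneg_right (mul_le_mul_of_nonneg_right sndDiffConst_le hP0) (add_nonneg hA hB))
  rcases le_or_gt (|(m : ℝ)|) t with hmt | hmt
  · -- Gaussian regime, shift `λ = m/t`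
    have hl : |(m : ℝ) / t| ≤ 1 := by rw [abs_div, abs_of_pos ht, div_le_one ht]; exact hmt
    have h := abs_sndDiff_srwHeatKernel_le_exp ht.le m hl
    have hexp : Real.exp (-((m : ℝ) / t * m) + t * (Real.cosh ((m : ℝ) / t) - 1)) ≤ Real.exp (-((m : ℝ) ^ 2 / (8 * t))) :=
      Real.exp_le_exp.2 (chernoff_exponent_gauss_le ht hmt)
    rcases eq_or_ne m 0 with hm0 | hm0
    · -- `m = 0`: `λ = 0`
      subst hm0
      have h' : 2 * π * D ≤ 256 * ((max 1 t)⁻¹ * (max 1 t) ^ (-(1 / 2 : ℝ))) := by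
        rw [hD]
        refine h.trans (le_of_eq ?_)
        simp
      have e1 : Real.exp (-(((0 : ℤ) : ℝ) ^ 2 / (16 * max 1 t))) + Real.exp (-(|((0 : ℤ) : ℝ)| / 16)) = 2 := by norm_num
      rw [e1]
      nlinarith [Real.pi_pos, hP0]
    · -- `m ≠ 0`: then `1 ≤ |m| ≤ t`, `T = t`
      have hm1 : (1 : ℝ) ≤ |(m : ℝ)| := by
        rw [← Int.cast_abs]; exact_mod_cast Int.one_le_abs hm0
      have ht1 : 1 ≤ t := hm1.trans hmt
      have hTt : max 1 t = t := max_eq_right ht1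
      rw [hTt] at hTT hsq hTinv hTn hP0 ⊢
      -- the Gaussian factor splits: `e^{−m²/8t} = e^{−m²/16t}·e^{−m²/16t}`
      have hsplit : Real.exp (-((m : ℝ) ^ 2 / (8 * t))) =
          Real.exp (-((m : ℝ) ^ 2 / (16 * t))) * Real.exp (-((m : ℝ) ^ 2 / (16 * t))) := by
        rw [← Real.exp_add]; congr 1; field_simp; ring
      -- `λ²·e^{−m²/16t} ≤ 7 t⁻¹`
      have hkey : ((m : ℝ) / t) ^ 2 * Real.exp (-((m : ℝ) ^ 2 / (16 * t))) ≤ 7 * t⁻¹ := by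
        have hx : (0 : ℝ) ≤ (m : ℝ) ^ 2 / t := by positivity
        have h7 := mul_exp_neg_div_sixteen_le hx
        have e1 : (m : ℝ) ^ 2 / t / 16 = (m : ℝ) ^ 2 / (16 * t) := by field_simp
        rw [e1] at h7
        calc ((m : ℝ) / t) ^ 2 * Real.exp (-((m : ℝ) ^ 2 / (16 * t)))
            = t⁻¹ * ((m : ℝ) ^ 2 / t * Real.exp (-((m : ℝ) ^ 2 / (16 * t)))) := by
              field_simp
          _ ≤ t⁻¹ * 7 := mul_le_mul_of_nonneg_left h7 (inv_nonneg.2 ht.le)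
          _ = 7 * t⁻¹ := mul_comm _ _
      have hexp16 : Real.exp (-((m : ℝ) ^ 2 / (16 * t))) ≤ 1 := by
        rw [Real.exp_le_one_iff]; exact neg_nonpos.2 (by positivity)
      calc 2 * π * D ≤ Real.exp (-((m : ℝ) / t * m) + t * (Real.cosh ((m : ℝ) / t) - 1)) *
            (256 * (t⁻¹ * t ^ (-(1 / 2 : ℝ))) + 8 * ((m : ℝ) / t) ^ 2 * (2 * π * t ^ (-(1 / 2 : ℝ)))) := by
            rw [hTt] at h; exact h
        _ ≤ Real.exp (-((m : ℝ) ^ 2 / (8 * t))) *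
            (256 * (t⁻¹ * t ^ (-(1 / 2 : ℝ))) + 8 * ((m : ℝ) / t) ^ 2 * (2 * π * t ^ (-(1 / 2 : ℝ)))) :=
            mul_le_mul_of_nonneg_right hexp (by positivity)
        _ = Real.exp (-((m : ℝ) ^ 2 / (16 * t))) * (256 * (t⁻¹ * t ^ (-(1 / 2 : ℝ))) * Real.exp (-((m : ℝ) ^ 2 / (16 * t)))
              + 16 * π * t ^ (-(1 / 2 : ℝ)) * (((m : ℝ) / t) ^ 2 * Real.exp (-((m : ℝ) ^ 2 / (16 * t))))) := by
            rw [hsplit]; ring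
        _ ≤ Real.exp (-((m : ℝ) ^ 2 / (16 * t))) * (256 * (t⁻¹ * t ^ (-(1 / 2 : ℝ))) * 1
              + 16 * π * t ^ (-(1 / 2 : ℝ)) * (7 * t⁻¹)) := by
            gcongr
        _ = (256 + 112 * π) * (t⁻¹ * t ^ (-(1 / 2 : ℝ))) * Real.exp (-((m : ℝ) ^ 2 / (16 * t))) := by ring
        _ ≤ (256 + 112 * π) * (t⁻¹ * t ^ (-(1 / 2 : ℝ))) *
              (Real.exp (-((m : ℝ) ^ 2 / (16 * t))) + Real.exp (-(|(m : ℝ)| / 16))) := by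
            have : 0 ≤ (256 + 112 * π) * (t⁻¹ * t ^ (-(1 / 2 : ℝ))) := by positivity
            exact mul_le_mul_of_nonneg_left (le_add_of_nonneg_right hB) this
  · -- Poisson regime, shift `λ = ±1`
    have hm0 : m ≠ 0 := by rintro rfl; simp at hmt; linarith
    obtain ⟨lam, hlam1, hlamm⟩ : ∃ lam : ℝ, |lam| = 1 ∧ lam * m = |(m : ℝ)| := by
      rcases lt_or_gt_of_ne hm0 with hneg | hpos
      · refine ⟨-1, by simp, ?_⟩
        have : (m : ℝ) < 0 := by exact_mod_cast hneg
        rw [abs_of_neg this]; ring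
      · refine ⟨1, by simp, ?_⟩
        have : (0 : ℝ) < m := by exact_mod_cast hpos
        rw [abs_of_pos this]; ring
    have hlam2 : lam ^ 2 = 1 := by rw [← sq_abs, hlam1, one_pow]
    have h := abs_sndDiff_srwHeatKernel_le_exp ht.le m (le_of_eq hlam1)
    rw [hlamm, hlam2] at h
    have hcosh : Real.cosh lam = Real.cosh 1 := by
      rcases (abs_eq (zero_le_one)).1 hlam1 with h1 | h1 <;> simp [h1]
    rw [hcosh] at h
    have hexp : Real.exp (-|(m : ℝ)| + t * (Real.cosh 1 - 1)) ≤ Real.exp (-(|(m : ℝ)| / 8)) :=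
      Real.exp_le_exp.2 (chernoff_exponent_poisson_le ht.le hmt.le)
    have hsplit : Real.exp (-(|(m : ℝ)| / 8)) = Real.exp (-(|(m : ℝ)| / 16)) * Real.exp (-(|(m : ℝ)| / 16)) := by
      rw [← Real.exp_add]; congr 1; ring
    -- `e^{−|m|/16} ≤ e^{−T/16}` and `T·e^{−T/16} ≤ 7`, so `e^{−|m|/16} ≤ 7·T⁻¹`
    have hkey : Real.exp (-(|(m : ℝ)| / 16)) ≤ 7 * (max 1 t)⁻¹ := by
      have hm1 : (1 : ℝ) ≤ |(m : ℝ)| := by rw [← Int.cast_abs]; exact_mod_cast Int.one_le_abs hm0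
      have hTm : max 1 t ≤ |(m : ℝ)| := max_le hm1 hmt.le
      have h1 : Real.exp (-(|(m : ℝ)| / 16)) ≤ Real.exp (-(max 1 t / 16)) := Real.exp_le_exp.2 (by linarith)
      have h2 := mul_exp_neg_div_sixteen_le hT0.le
      calc Real.exp (-(|(m : ℝ)| / 16)) ≤ Real.exp (-(max 1 t / 16)) := h1
        _ = (max 1 t)⁻¹ * (max 1 t * Real.exp (-(max 1 t / 16))) := by field_simp
        _ ≤ (max 1 t)⁻¹ * 7 := mul_le_mul_of_nonneg_left h2 hTinv
        _ = 7 * (max 1 t)⁻¹ := mul_comm _ _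
    have hexp16 : Real.exp (-(|(m : ℝ)| / 16)) ≤ 1 := by
      rw [Real.exp_le_one_iff]; exact neg_nonpos.2 (by positivity)
    calc 2 * π * D ≤ Real.exp (-|(m : ℝ)| + t * (Real.cosh 1 - 1)) *
          (256 * ((max 1 t)⁻¹ * (max 1 t) ^ (-(1 / 2 : ℝ))) + 8 * 1 * (2 * π * (max 1 t) ^ (-(1 / 2 : ℝ)))) := h
      _ ≤ Real.exp (-(|(m : ℝ)| / 8)) *
          (256 * ((max 1 t)⁻¹ * (max 1 t) ^ (-(1 / 2 : ℝ))) + 8 * 1 * (2 * π * (max 1 t) ^ (-(1 / 2 : ℝ)))) :=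
          mul_le_mul_of_nonneg_right hexp (by positivity)
      _ = Real.exp (-(|(m : ℝ)| / 16)) * (256 * ((max 1 t)⁻¹ * (max 1 t) ^ (-(1 / 2 : ℝ))) * Real.exp (-(|(m : ℝ)| / 16))
            + 16 * π * (max 1 t) ^ (-(1 / 2 : ℝ)) * Real.exp (-(|(m : ℝ)| / 16))) := by rw [hsplit]; ring
      _ ≤ Real.exp (-(|(m : ℝ)| / 16)) * (256 * ((max 1 t)⁻¹ * (max 1 t) ^ (-(1 / 2 : ℝ))) * 1
            + 16 * π * (max 1 t) ^ (-(1 / 2 : ℝ)) * (7 * (max 1 t)⁻¹)) := by gcongr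
      _ = (256 + 112 * π) * ((max 1 t)⁻¹ * (max 1 t) ^ (-(1 / 2 : ℝ))) * Real.exp (-(|(m : ℝ)| / 16)) := by ring
      _ ≤ (256 + 112 * π) * ((max 1 t)⁻¹ * (max 1 t) ^ (-(1 / 2 : ℝ))) *
            (Real.exp (-((m : ℝ) ^ 2 / (16 * max 1 t))) + Real.exp (-(|(m : ℝ)| / 16))) := by
          have : 0 ≤ (256 + 112 * π) * ((max 1 t)⁻¹ * (max 1 t) ^ (-(1 / 2 : ℝ))) := by positivity
          exact mul_le_mul_of_nonneg_left (le_add_of_nonneg_left hA) this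

end Pointwise
/-! ## §3  The exponentially weighted ℓ¹ bound on `ℤ` -/
section Weighted

/-- **WEIGHTED ℓ¹ BOUND FOR THE SECOND DIFFERENCE**: for `t > 0`, `β ≤ 1/32`, `T = 1 ∨ t`,
`Σ_{m ∈ ℤ} e^{β|m|}|q_t(m+1) − 2q_t(m) + q_t(m−1)| ≤ 8400·T⁻¹·e^{8β²T}`, with summability — ONE factor `T⁻¹` beyond the kernel itself,
uniformly in the weight (`β < 0` allowed). [folklore] -/
theorem weighted_tsum_sndDiff_srw_le {t : ℝ} (ht : 0 < t) {β : ℝ} (hβ : β ≤ 1 / 32) :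
    Summable (fun m : ℤ => Real.exp (β * |(m : ℝ)|) *
        |srwHeatKernel t (m + 1) - 2 * srwHeatKernel t m + srwHeatKernel t (m - 1)|) ∧
      ∑' m : ℤ, Real.exp (β * |(m : ℝ)|) * |srwHeatKernel t (m + 1) - 2 * srwHeatKernel t m + srwHeatKernel t (m - 1)|
        ≤ 8400 * (max 1 t)⁻¹ * Real.exp (8 * β ^ 2 * max 1 t) := by
  obtain ⟨hT1, hT0, hThalf, hTT, hsq⟩ := max_one_facts t
  set T := max 1 t with hTdef
  have ha : 0 < 1 / (16 * T) := by positivity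
  obtain ⟨hS1, hB1⟩ := tsum_exp_weight_gauss_le ha β
  obtain ⟨hS2, hB2⟩ := tsum_exp_neg_mul_abs_le (show (0 : ℝ) < 1 / 32 by norm_num)
  have hTinv : 0 ≤ T⁻¹ := inv_nonneg.2 hT0.le
  have hTn : 0 ≤ T ^ (-(1 / 2 : ℝ)) := Real.rpow_nonneg hT0.le _
  have hc : 0 ≤ 100 * (T⁻¹ * T ^ (-(1 / 2 : ℝ))) := by positivity
  have hpt : ∀ m : ℤ, Real.exp (β * |(m : ℝ)|) * |srwHeatKernel t (m + 1) - 2 * srwHeatKernel t m + srwHeatKernel t (m - 1)|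
      ≤ 100 * (T⁻¹ * T ^ (-(1 / 2 : ℝ))) * (Real.exp (β * |(m : ℝ)|) * Real.exp (-(1 / (16 * T) * (m : ℝ) ^ 2)))
        + 100 * (T⁻¹ * T ^ (-(1 / 2 : ℝ))) * Real.exp (-(1 / 32 * |(m : ℝ)|)) := by
    intro m
    have h := abs_sndDiff_srw_le_hybrid ht m
    have hw : 0 ≤ Real.exp (β * |(m : ℝ)|) := (Real.exp_pos _).le
    have e1 : Real.exp (-((m : ℝ) ^ 2 / (16 * T))) = Real.exp (-(1 / (16 * T) * (m : ℝ) ^ 2)) := by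
      congr 1; field_simp
    have e2 : Real.exp (β * |(m : ℝ)|) * Real.exp (-(|(m : ℝ)| / 16)) ≤ Real.exp (-(1 / 32 * |(m : ℝ)|)) := by
      rw [← Real.exp_add]; refine Real.exp_le_exp.2 ?_; nlinarith [abs_nonneg (m : ℝ)]
    calc Real.exp (β * |(m : ℝ)|) * |srwHeatKernel t (m + 1) - 2 * srwHeatKernel t m + srwHeatKernel t (m - 1)|
        ≤ Real.exp (β * |(m : ℝ)|) * (100 * (T⁻¹ * T ^ (-(1 / 2 : ℝ))) *
            (Real.exp (-((m : ℝ) ^ 2 / (16 * T))) + Real.exp (-(|(m : ℝ)| / 16)))) := mul_le_mul_of_nonneg_left h hw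
      _ = 100 * (T⁻¹ * T ^ (-(1 / 2 : ℝ))) * (Real.exp (β * |(m : ℝ)|) * Real.exp (-(1 / (16 * T) * (m : ℝ) ^ 2)))
            + 100 * (T⁻¹ * T ^ (-(1 / 2 : ℝ))) * (Real.exp (β * |(m : ℝ)|) * Real.exp (-(|(m : ℝ)| / 16))) := by
          rw [e1]; ring
      _ ≤ 100 * (T⁻¹ * T ^ (-(1 / 2 : ℝ))) * (Real.exp (β * |(m : ℝ)|) * Real.exp (-(1 / (16 * T) * (m : ℝ) ^ 2)))
            + 100 * (T⁻¹ * T ^ (-(1 / 2 : ℝ))) * Real.exp (-(1 / 32 * |(m : ℝ)|)) := by gcongr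
  have hnn : ∀ m : ℤ, 0 ≤ Real.exp (β * |(m : ℝ)|) *
      |srwHeatKernel t (m + 1) - 2 * srwHeatKernel t m + srwHeatKernel t (m - 1)| := fun m => by positivity
  obtain ⟨hS, hB⟩ := tsum_le_of_le_add hnn hpt hS1 hS2 hB1 hB2 hc hc
  refine ⟨hS, hB.trans ?_⟩
  -- numerics
  have hsqrt16T : Real.sqrt (1 / (16 * T)) = (4 * Real.sqrt T)⁻¹ := by
    rw [Real.sqrt_div' _ (by positivity : (0:ℝ) ≤ 16 * T), Real.sqrt_one, one_div, Real.sqrt_mul (by norm_num),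
      show Real.sqrt 16 = 4 by rw [show (16:ℝ) = 4 ^ 2 by norm_num, Real.sqrt_sq (by norm_num)]]
  have hexp : Real.exp (β ^ 2 / (2 * (1 / (16 * T))) + 1 / 2) = Real.exp (8 * β ^ 2 * T) * Real.exp (1 / 2) := by
    rw [← Real.exp_add]; congr 1; field_simp; ring
  have hE0 : 0 ≤ Real.exp (8 * β ^ 2 * T) := (Real.exp_pos _).le
  have hE1 : 1 ≤ Real.exp (8 * β ^ 2 * T) := Real.one_le_exp (by positivity)
  have hsqT1 : 1 ≤ Real.sqrt T := by rw [show (1:ℝ) = Real.sqrt 1 by simp]; exact Real.sqrt_le_sqrt hT1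
  have hgauss : 100 * (T⁻¹ * T ^ (-(1 / 2 : ℝ))) *
      (2 * (1 + (Real.sqrt (1 / (16 * T)))⁻¹) * Real.exp (β ^ 2 / (2 * (1 / (16 * T))) + 1 / 2))
      ≤ 1750 * T⁻¹ * Real.exp (8 * β ^ 2 * T) := by
    rw [hsqrt16T, inv_inv, hexp]
    have h1 : T ^ (-(1 / 2 : ℝ)) * (1 + 4 * Real.sqrt T) ≤ 5 := by
      calc T ^ (-(1 / 2 : ℝ)) * (1 + 4 * Real.sqrt T) ≤ T ^ (-(1 / 2 : ℝ)) * (Real.sqrt T + 4 * Real.sqrt T) := by gcongr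
        _ = 5 * (Real.sqrt T * T ^ (-(1 / 2 : ℝ))) := by ring
        _ = 5 := by rw [hsq, mul_one]
    calc 100 * (T⁻¹ * T ^ (-(1 / 2 : ℝ))) * (2 * (1 + 4 * Real.sqrt T) * (Real.exp (8 * β ^ 2 * T) * Real.exp (1 / 2)))
        = 200 * (T ^ (-(1 / 2 : ℝ)) * (1 + 4 * Real.sqrt T)) * Real.exp (1 / 2) * (T⁻¹ * Real.exp (8 * β ^ 2 * T)) := by
          ring
      _ ≤ 200 * 5 * (7 / 4) * (T⁻¹ * Real.exp (8 * β ^ 2 * T)) := by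
          gcongr
          exact exp_half_le
      _ = 1750 * T⁻¹ * Real.exp (8 * β ^ 2 * T) := by ring
  have hpois : 100 * (T⁻¹ * T ^ (-(1 / 2 : ℝ))) * (2 * (1 + (1 / 32 : ℝ)⁻¹)) ≤ 6600 * T⁻¹ * Real.exp (8 * β ^ 2 * T) := by
    have h1 : T⁻¹ * T ^ (-(1 / 2 : ℝ)) ≤ T⁻¹ * 1 := mul_le_mul_of_nonneg_left hThalf hTinv
    norm_num
    nlinarith [mul_nonneg hTinv hE0, mul_le_mul_of_nonneg_left hE1 hTinv]
  nlinarith [mul_nonneg hTinv hE0]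

end Weighted
/-! ## §4  On the discrete circle `ℤ/P`: centred and forward forms -/
section TorusKernel

variable {P : ℕ} [NeZero P]

/-- **`Σ_{c ∈ ℤ/P} e^{β|c̃|}|q^P_t(c+1) − 2q^P_t(c) + q^P_t(c−1)| ≤ 8400·T⁻¹·e^{8β²T}`** for `t > 0`, `0 ≤ β ≤ 1/32`, `T = 1 ∨ t`,
uniformly in `P` (periodisation is a weighted ℓ¹ contraction, part 9 §1). [folklore] -/
theorem weighted_sum_sndDiff_torusHeatKernel_le {t : ℝ} (ht : 0 < t) {β : ℝ} (hβ0 : 0 ≤ β) (hβ : β ≤ 1 / 32) :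
    ∑ c : ZMod P, Real.exp (β * |((c.valMinAbs : ℤ) : ℝ)|) *
        |torusHeatKernel t (c + 1) - 2 * torusHeatKernel t c + torusHeatKernel t (c - 1)|
      ≤ 8400 * (max 1 t)⁻¹ * Real.exp (8 * β ^ 2 * max 1 t) := by
  obtain ⟨hS0, -⟩ := weighted_tsum_sndDiff_srw_le ht (show (0 : ℝ) ≤ 1 / 32 by norm_num)
  obtain ⟨hSw, hBw⟩ := weighted_tsum_sndDiff_srw_le ht hβ
  have hfa : Summable fun m : ℤ => |srwHeatKernel t (m + 1) - 2 * srwHeatKernel t m + srwHeatKernel t (m - 1)| := by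
    simpa using hS0
  refine le_trans ?_ hBw
  refine sum_weight_abs_periodic_le (fun m : ℤ => Real.exp (β * |(m : ℝ)|))
    (fun m => srwHeatKernel t (m + 1) - 2 * srwHeatKernel t m + srwHeatKernel t (m - 1))
    (fun c => torusHeatKernel t (c + 1) - 2 * torusHeatKernel t c + torusHeatKernel t (c - 1))
    (fun m => (Real.exp_pos _).le) (fun c k => expWeight_mono hβ0 c k) hfa hSw fun c => ?_
  obtain ⟨hs, heq⟩ := torusHeatKernel_eq_tsum (L := P) ht c.valMinAbs
  obtain ⟨hs1, heq1⟩ := torusHeatKernel_eq_tsum (L := P) ht (c.valMinAbs + 1)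
  obtain ⟨hs2, heq2⟩ := torusHeatKernel_eq_tsum (L := P) ht (c.valMinAbs - 1)
  rw [ZMod.coe_valMinAbs] at heq
  have hc1 : (((c.valMinAbs + 1 : ℤ)) : ZMod P) = c + 1 := by push_cast; simp
  have hc2 : (((c.valMinAbs - 1 : ℤ)) : ZMod P) = c - 1 := by push_cast; simp
  rw [hc1] at heq1
  rw [hc2] at heq2
  have hshift1 : (fun w : ℤ => srwHeatKernel t (c.valMinAbs + 1 + w * P)) = fun w => srwHeatKernel t (c.valMinAbs + w * P + 1) := by
    funext w; ring_nf
  have hshift2 : (fun w : ℤ => srwHeatKernel t (c.valMinAbs - 1 + w * P)) = fun w => srwHeatKernel t (c.valMinAbs + w * P - 1) := by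
    funext w; ring_nf
  rw [hshift1] at hs1 heq1
  rw [hshift2] at hs2 heq2
  have hs3 : Summable fun w : ℤ => 2 * srwHeatKernel t (c.valMinAbs + w * P) := hs.mul_left 2
  have heq3 : 2 * torusHeatKernel t c = ∑' w : ℤ, 2 * srwHeatKernel t (c.valMinAbs + w * P) := by
    rw [heq, tsum_mul_left]
  rw [heq1, heq2, heq3, ← Summable.tsum_sub hs1 hs3, ← Summable.tsum_add (hs1.sub hs3) hs2]
  exact ((hs1.sub hs3).add hs2).hasSum

/-- The centred representative of `c − 1` is at most one longer than that of `c`: `|(c−1)~| ≤ |c̃| + 1`. [folklore] -/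
theorem abs_valMinAbs_sub_one_le (c : ZMod P) :
    |(((c - 1 : ZMod P).valMinAbs : ℤ) : ℝ)| ≤ |((c.valMinAbs : ℤ) : ℝ)| + 1 := by
  have hcast : (((c.valMinAbs - 1 : ℤ)) : ZMod P) = c - 1 := by push_cast; simp
  obtain ⟨k, hk⟩ := exists_eq_valMinAbs_add_mul hcast
  have h1 := abs_valMinAbs_le_abs_add_mul (c - 1) k
  rw [← hk] at h1
  have h2 : |(c.valMinAbs : ℤ) - 1| ≤ |(c.valMinAbs : ℤ)| + 1 := by
    calc |(c.valMinAbs : ℤ) - 1| ≤ |(c.valMinAbs : ℤ)| + |(1 : ℤ)| := abs_sub _ _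
      _ = |(c.valMinAbs : ℤ)| + 1 := by simp
  have h3 : |((c - 1 : ZMod P).valMinAbs : ℤ)| ≤ |(c.valMinAbs : ℤ)| + 1 := h1.trans h2
  rw [← Int.cast_abs, ← Int.cast_abs]
  exact_mod_cast h3

/-- A unit shift of the argument against the centred exponential weight costs at most `e^{β}`:
`Σ_c e^{β|c̃|} g(c+1) ≤ e^{β}·Σ_c e^{β|c̃|} g(c)` for `g ≥ 0`, `β ≥ 0`. [folklore] -/
theorem weighted_sum_shift_le {β : ℝ} (hβ0 : 0 ≤ β) (g : ZMod P → ℝ) (hg : ∀ c, 0 ≤ g c) :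
    ∑ c : ZMod P, Real.exp (β * |((c.valMinAbs : ℤ) : ℝ)|) * g (c + 1)
      ≤ Real.exp β * ∑ c : ZMod P, Real.exp (β * |((c.valMinAbs : ℤ) : ℝ)|) * g c := by
  have hre : ∑ c : ZMod P, Real.exp (β * |((c.valMinAbs : ℤ) : ℝ)|) * g (c + 1)
      = ∑ c : ZMod P, Real.exp (β * |(((c - 1 : ZMod P).valMinAbs : ℤ) : ℝ)|) * g c := by
    refine Fintype.sum_equiv (Equiv.addRight (1 : ZMod P)) _ _ fun c => ?_
    simp
  rw [hre, Finset.mul_sum]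
  refine Finset.sum_le_sum fun c _ => ?_
  have h1 : Real.exp (β * |(((c - 1 : ZMod P).valMinAbs : ℤ) : ℝ)|) ≤ Real.exp β * Real.exp (β * |((c.valMinAbs : ℤ) : ℝ)|) := by
    rw [← Real.exp_add]
    refine Real.exp_le_exp.2 ?_
    have := abs_valMinAbs_sub_one_le c
    nlinarith
  calc Real.exp (β * |(((c - 1 : ZMod P).valMinAbs : ℤ) : ℝ)|) * g c
      ≤ (Real.exp β * Real.exp (β * |((c.valMinAbs : ℤ) : ℝ)|)) * g c := mul_le_mul_of_nonneg_right h1 (hg c)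
    _ = _ := by ring

/-- `e^{1/32} ≤ 33/32·(1 + 1/1000)` in the usable form `8400·e^{β} ≤ 8700` for `0 ≤ β ≤ 1/32`. [folklore] -/
theorem const_shift_le {β : ℝ} (hβ : β ≤ 1 / 32) : 8400 * Real.exp β ≤ 8700 := by
  have h1 : Real.exp β ≤ Real.exp (1 / 32) := Real.exp_le_exp.2 hβ
  have h2 : Real.exp (1 / 32 : ℝ) ≤ 1 + 1 / 32 + (1 / 32) ^ 2 := by
    have h := Real.exp_bound' (x := 1 / 32) (by norm_num) (by norm_num) (n := 2) (by norm_num)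
    simp only [Finset.sum_range_succ, Finset.sum_range_zero, Nat.factorial] at h
    norm_num at h
    linarith
  nlinarith

/-- **Forward form**: **`Σ_{c ∈ ℤ/P} e^{β|c̃|}|q^P_t(c+2) − 2q^P_t(c+1) + q^P_t(c)| ≤ 8700·T⁻¹·e^{8β²T}`** for `t > 0`, `0 ≤ β ≤ 1/32`,
`T = 1 ∨ t`, uniformly in `P` — the shape produced by two forward unit row differences of the product heat kernel in one
coordinate (part 2 of this chain). [folklore] -/
theorem weighted_sum_fwdSndDiff_torusHeatKernel_le {t : ℝ} (ht : 0 < t) {β : ℝ} (hβ0 : 0 ≤ β) (hβ : β ≤ 1 / 32) :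
    ∑ c : ZMod P, Real.exp (β * |((c.valMinAbs : ℤ) : ℝ)|) *
        |torusHeatKernel t (c + 2) - 2 * torusHeatKernel t (c + 1) + torusHeatKernel t c|
      ≤ 8700 * (max 1 t)⁻¹ * Real.exp (8 * β ^ 2 * max 1 t) := by
  obtain ⟨-, hT0, -, -, -⟩ := max_one_facts t
  set g : ZMod P → ℝ := fun c => |torusHeatKernel t (c + 1) - 2 * torusHeatKernel t c + torusHeatKernel t (c - 1)| with hg
  have hg0 : ∀ c, 0 ≤ g c := fun c => abs_nonneg _
  have hfwd : ∀ c : ZMod P, |torusHeatKernel t (c + 2) - 2 * torusHeatKernel t (c + 1) + torusHeatKernel t c| = g (c + 1) := by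
    intro c
    simp only [hg]
    congr 2
    · congr 2; ring
    · simp
  simp only [hfwd]
  have h1 := weighted_sum_shift_le hβ0 g hg0
  have h2 := weighted_sum_sndDiff_torusHeatKernel_le (P := P) ht hβ0 hβ
  have hE : 0 ≤ (max 1 t)⁻¹ * Real.exp (8 * β ^ 2 * max 1 t) := by positivity
  calc ∑ c : ZMod P, Real.exp (β * |((c.valMinAbs : ℤ) : ℝ)|) * g (c + 1)
      ≤ Real.exp β * ∑ c : ZMod P, Real.exp (β * |((c.valMinAbs : ℤ) : ℝ)|) * g c := h1
    _ ≤ Real.exp β * (8400 * (max 1 t)⁻¹ * Real.exp (8 * β ^ 2 * max 1 t)) :=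
        mul_le_mul_of_nonneg_left h2 (Real.exp_pos _).le
    _ = (8400 * Real.exp β) * ((max 1 t)⁻¹ * Real.exp (8 * β ^ 2 * max 1 t)) := by ring
    _ ≤ 8700 * ((max 1 t)⁻¹ * Real.exp (8 * β ^ 2 * max 1 t)) := mul_le_mul_of_nonneg_right (const_shift_le hβ) hE
    _ = _ := by ring

end TorusKernel

end Summit.QuantumFields.BalabanUV.Beta.GAN24.SliceFlatHeatSecond
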